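import Literature.MathematicalPhysics.QuantumFieldTheory.Balaban1983to89.T3FinestHeightTail

/-!
# `Balaban1983to89.T3BareTailProfile` — rung R3, crux K2 `HistoryTail`: the per-height tail `HeightTailAt` SPLITS into
# its bare (height-`0`) and averaged (heights `≥ 1`) parts, and the BARE PART IS PROVED (summable profile, uniform in
# the cutoff) — K2's open content is exactly the averaged heights

Cell `ym3-torus` (HUMAN RULING D-0037, YM ladder rung R3), seat `ym3-torus-p2` gen 4.  `T3CruxEstimates.HeightTailAt F γ b₀ p₀`
(K2's ONE estimate, `m`-free) asks for a profile `q ≥ 0` with `Σ q < ∞`, `Σ_n Σ'_t q(t+n) < ∞` and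
`Gibbs_K{¬PlaqSmall θ(K−j) (Ū^{j})} ≤ q(K−j)` for all `K`, `j ≤ K`.  Here:

* `BareTailAt` / `AveragedTailAt` — the `j = 0` and the `1 ≤ j ≤ K` slices, each with its own profile;
  `heightTailAt_iff_bare_and_averaged : HeightTailAt ↔ BareTailAt ∧ AveragedTailAt` (profiles add).
* **`bareTailAt`** — for `0 < γ ≤ 1`, `0 < b₀`, `1 ≤ p₀` (print: `p₀ > 2`, `b₀` large): `BareTailAt F γ b₀ p₀` HOLDS, with the
  geometric profile `q(i) = A·2^{−i}`: from the landed finest-height bound `T3FinestHeightTail.gibbsK_real_not_plaqSmall_le`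
  (lit seat g8, p410507: reflection positivity + chessboard, `Gibbs_K{¬PlaqSmall θ(K)} ≤ #Plaq·2e^{24}c⁻³·(√β_K)⁹·e^{−p(g_K)²/4}`)
  and the elementary estimate
  `p(g_K) = b₀(1 + ½(K log L − log γ))^{p₀} ≥ ½ b₀ K log L`, so that the Gaussian factor `e^{−b₀²(log L)²K²/16}` beats the
  polynomial prefactor `L^{8K}` and a further `2^K` (`quadratic_le`: `bt − at² ≤ b²/4a`).
* `heightTailAt_iff_averagedTailAt` — under the same hypotheses `HeightTailAt F γ b₀ p₀ ↔ AveragedTailAt F γ b₀ p₀`: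
  **the crux K2 is reduced to the block-AVERAGED heights `j ≥ 1`** (the part that needs the renormalisation-group
  representation of Bałaban's densities `ρ_j`, [Balaban1985UV3] (41)/(71)); route-shaped packaging is the Summits-side support file
  `UnitScaleTiltHistoryTailAveraged`.

WHAT THIS IS NOT: not the averaged heights, not K1, no continuum statement.  Printed neighbour of the bare term: Gross,
CMP 92 (1983) Thm. 3.6 (3.10) (abelian).
-/

noncomputable section

open MeasureTheory Filter Topology
open Literature.MathematicalPhysics.QuantumFieldTheory.Balaban1983to89.T3ContinuumYM3Torus
open Literature.MathematicalPhysics.QuantumFieldTheory.Balaban1983to89.T3UnitScaleTilt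
open Literature.MathematicalPhysics.QuantumFieldTheory.Balaban1983to89.T3UnitLawDensityEML
open Literature.MathematicalPhysics.QuantumFieldTheory.Balaban1983to89.T3CruxEstimates
open Literature.MathematicalPhysics.QuantumFieldTheory.Balaban1983to89.T3FinestHeightTail

namespace Literature.MathematicalPhysics.QuantumFieldTheory.Balaban1983to89.T3BareTailProfile

/-! ## §1 The split of `HeightTailAt` into its bare and averaged parts -/

section Split

variable (F : T3Family) (γ b₀ p₀ : ℝ)

/-- **THE BARE (height-`0`) PART OF K2's ESTIMATE**: a profile `q ≥ 0`, `Σ q < ∞`, `Σ_n Σ'_t q(t+n) < ∞`, with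
`Gibbs_K{U : ¬PlaqSmall θ(K) U} ≤ q(K)` for every approximation `K` (the bare plaquettes of `T_ε^{(K)}` at threshold
`θ(K) = g_K p(g_K)`). [cite: Balaban1985UV3, (7) p.257] -/
def BareTailAt : Prop :=
  ∃ q : ℕ → ℝ, (∀ i, 0 ≤ q i) ∧ Summable q ∧ (Summable fun n => ∑' t, q (t + n)) ∧
    ∀ K, (gibbsK F ℰp γ K).real {U | ¬ PlaqSmall (θBal F.L γ b₀ p₀ K) U} ≤ q K

/-- **THE AVERAGED (heights `j ≥ 1`) PART OF K2's ESTIMATE**: a profile as above with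
`Gibbs_K{U : ¬PlaqSmall θ(K−j) (Ū^{j})} ≤ q(K−j)` for all `K` and `1 ≤ j ≤ K` — the weight of Bałaban's density `ρ_j` on
the height-`j` large-field region, NOT proved here. [cite: Balaban1985UV3, (71) p.273] -/
def AveragedTailAt : Prop :=
  ∃ q : ℕ → ℝ, (∀ i, 0 ≤ q i) ∧ Summable q ∧ (Summable fun n => ∑' t, q (t + n)) ∧
    ∀ K j, 1 ≤ j → j ≤ K → (gibbsK F ℰp γ K).real
      {U | ¬ PlaqSmall (θBal F.L γ b₀ p₀ (K - j))
        (Averaging.iter (fun i => BlockAveraging.blockAvg (P := F.P K) (j := i) ℰp) j U)} ≤ q (K - j)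

variable {F γ b₀ p₀}

/-- Shifted tails of a non-negative summable profile are summable. [folklore] -/
private theorem summable_shift {q : ℕ → ℝ} (hq : Summable q) (n : ℕ) : Summable fun t => q (t + n) :=
  (summable_nat_add_iff n).mpr hq

/-- **`HeightTailAt ↔ BareTailAt ∧ AveragedTailAt`** (the two slices with the SAME profile one way; the SUM of the two
profiles the other way). [cite: Balaban1985UV3, (7) p.257 and (71) p.273] -/
theorem heightTailAt_iff_bare_and_averaged :
    HeightTailAt F γ b₀ p₀ ↔ BareTailAt F γ b₀ p₀ ∧ AveragedTailAt F γ b₀ p₀ := by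
  constructor
  · rintro ⟨q, hq0, hq, hqt, h⟩
    refine ⟨⟨q, hq0, hq, hqt, fun K => ?_⟩, ⟨q, hq0, hq, hqt, fun K j _ hj => h K j hj⟩⟩
    have hK := h K 0 (Nat.zero_le K)
    exact hK
  · rintro ⟨⟨q₁, hq₁0, hq₁, hq₁t, h₁⟩, ⟨q₂, hq₂0, hq₂, hq₂t, h₂⟩⟩
    refine ⟨fun i => q₁ i + q₂ i, fun i => add_nonneg (hq₁0 i) (hq₂0 i), hq₁.add hq₂, ?_, fun K j hj => ?_⟩
    · have heq : (fun n => ∑' t, (q₁ (t + n) + q₂ (t + n))) = fun n => (∑' t, q₁ (t + n)) + ∑' t, q₂ (t + n) := by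
        funext n
        exact (summable_shift hq₁ n).tsum_add (summable_shift hq₂ n)
      rw [heq]
      exact hq₁t.add hq₂t
    · rcases Nat.eq_zero_or_pos j with rfl | hjpos
      · have hK : (gibbsK F ℰp γ K).real
            {U | ¬ PlaqSmall (θBal F.L γ b₀ p₀ (K - 0))
              (Averaging.iter (fun i => BlockAveraging.blockAvg (P := F.P K) (j := i) ℰp) 0 U)} ≤ q₁ (K - 0) := h₁ K
        exact hK.trans (le_add_of_nonneg_right (hq₂0 _))
      · exact (h₂ K j hjpos hj).trans (le_add_of_nonneg_left (hq₁0 _))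

end Split

/-! ## §2 The bare part holds: a geometric profile from the landed finest-height bound -/

section Profile

/-- Completing the square: `b t − a t² ≤ b²/(4a)` for `a > 0`. [folklore] -/
private theorem quadratic_le {a : ℝ} (ha : 0 < a) (b t : ℝ) : b * t - a * t ^ 2 ≤ b ^ 2 / (4 * a) := by
  rw [le_div_iff₀ (by positivity)]
  nlinarith [sq_nonneg (2 * a * t - b)]

/-- `(√y)⁹ ≤ y⁵` for `y ≥ 1`. [folklore] -/
private theorem sqrt_pow_nine_le {y : ℝ} (hy : 1 ≤ y) : Real.sqrt y ^ 9 ≤ y ^ 5 := by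
  have hy0 : 0 ≤ y := zero_le_one.trans hy
  have hs : Real.sqrt y ^ 2 = y := Real.sq_sqrt hy0
  have hsy : Real.sqrt y ≤ y := by
    rw [Real.sqrt_le_left hy0]  -- `√y ≤ y ↔ y ≤ y ^ 2` for `0 ≤ y`
    nlinarith
  calc Real.sqrt y ^ 9 = (Real.sqrt y ^ 2) ^ 4 * Real.sqrt y := by ring
    _ = y ^ 4 * Real.sqrt y := by rw [hs]
    _ ≤ y ^ 4 * y := by gcongr
    _ = y ^ 5 := by ring

/-- The finest lattice of the `K`-th approximation has `2L^{m+K}` sites per direction. [cite: Balaban1985UV3, (1)-(3) p.256] -/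
private theorem sitesPerDir_zero (F : T3Family) (K : ℕ) : (F.P K).sitesPerDir 0 = 2 * F.L ^ (F.m + K) := by
  simp [Params.sitesPerDir]

/-- The bare inverse coupling of the `K`-th approximation: `β_K = (γ ε_K)⁻¹ = (γ L^{−K})⁻¹`. [cite: Balaban1985UV3, (1)-(3) p.256] -/
private theorem scheme_β_eq (F : T3Family) (γ : ℝ) (K : ℕ) : (F.scheme ℰp γ).β K = (γ * ((F.L : ℝ)⁻¹) ^ K)⁻¹ := rfl

/-- `#plaquettes of T_ε^{(K)} ≤ 9·(sites per direction)³` (crude: `d² = 9` plane labels per site). [cite: Balaban1985UV3, (1)-(3) p.256] -/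
private theorem card_plaq_le (F : T3Family) (K : ℕ) :
    (Fintype.card (Plaq (F.P K) 0) : ℝ) ≤ 9 * ((F.P K).sitesPerDir 0 : ℝ) ^ 3 := by
  have h1 : Fintype.card (Plaq (F.P K) 0) = Fintype.card (Plaquette 3 ((F.P K).sitesPerDir 0)) :=
    Fintype.card_congr (plaqEquiv (P := F.P K) 0)
  have h2 : Fintype.card (Plaquette 3 ((F.P K).sitesPerDir 0)) ≤ ((F.P K).sitesPerDir 0) ^ 3 * 3 ^ 2 := by
    rw [Fintype.card_prod, Fintype.card_fun, ZMod.card, Fintype.card_fin]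
    gcongr
    calc Fintype.card {p : Fin 3 × Fin 3 // p.1 < p.2} ≤ Fintype.card (Fin 3 × Fin 3) := Fintype.card_subtype_le _
      _ = 3 ^ 2 := by rw [Fintype.card_prod, Fintype.card_fin]; norm_num
  rw [h1]
  calc (Fintype.card (Plaquette 3 ((F.P K).sitesPerDir 0)) : ℝ) ≤ (((F.P K).sitesPerDir 0) ^ 3 * 3 ^ 2 : ℕ) := by
        exact_mod_cast h2
    _ = 9 * ((F.P K).sitesPerDir 0 : ℝ) ^ 3 := by push_cast; ring

/-- **THE BARE PART OF K2 HOLDS** (`0 < γ ≤ 1`, `0 < b₀`, `1 ≤ p₀`): `BareTailAt F γ b₀ p₀`, with the geometric profile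
`q(i) = A·2^{−i}`.  From `T3FinestHeightTail.gibbsK_real_not_plaqSmall_le` (reflection positivity + chessboard + small balls) and
`p(g_K) = b₀(1 + ½(K log L − log γ))^{p₀} ≥ ½ b₀ K log L` (`γ ≤ 1`, `p₀ ≥ 1`): the factor `e^{−p(g_K)²/4} ≤
e^{−b₀²(log L)²K²/16}` beats `L^{8K}·2^K`. [cite: Balaban1985UV3, (7) p.257 and (71) p.273] -/
theorem bareTailAt (F : T3Family) {γ b₀ p₀ : ℝ} (hγ : 0 < γ) (hγ1 : γ ≤ 1) (hb₀ : 0 < b₀) (hp₀ : 1 ≤ p₀) :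
    BareTailAt F γ b₀ p₀ := by
  obtain ⟨C, hC, -, hbound⟩ := gibbsK_real_not_plaqSmall_le
  -- constants
  have hL1 : (1 : ℝ) < F.L := by exact_mod_cast F.hL.2
  have hL0 : (0 : ℝ) < F.L := one_pos.trans hL1
  set ℓ : ℝ := Real.log F.L with hℓ
  have hℓ0 : 0 < ℓ := Real.log_pos hL1
  have hlogγ : Real.log γ ≤ 0 := Real.log_nonpos hγ.le hγ1
  set a : ℝ := b₀ ^ 2 * ℓ ^ 2 / 16 with ha
  have ha0 : 0 < a := by positivity
  set b : ℝ := 8 * ℓ + Real.log 2 with hb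
  set A : ℝ := 144 * Real.exp 24 * (C ^ 3)⁻¹ * (F.L : ℝ) ^ (3 * F.m) * γ⁻¹ ^ 5 * Real.exp (b ^ 2 / (4 * a)) with hA
  have hA0 : 0 ≤ A := by positivity
  -- the profile
  refine ⟨fun i => A * (1 / 2 : ℝ) ^ i, fun i => by positivity, ?_, ?_, fun K => ?_⟩
  · exact (summable_geometric_of_lt_one (by norm_num) (by norm_num)).mul_left A
  · have heq : (fun n => ∑' t, A * (1 / 2 : ℝ) ^ (t + n)) = fun n => (2 * A) * (1 / 2 : ℝ) ^ n := by
      funext n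
      have h1 : (fun t => A * (1 / 2 : ℝ) ^ (t + n)) = fun t => (A * (1 / 2 : ℝ) ^ n) * (1 / 2 : ℝ) ^ t := by
        funext t; rw [pow_add]; ring
      rw [h1, tsum_mul_left, tsum_geometric_two]; ring
    rw [heq]
    exact (summable_geometric_of_lt_one (by norm_num) (by norm_num)).mul_left (2 * A)
  -- the estimate for the `K`-th approximation
  set x : ℝ := γ * ((F.L : ℝ)⁻¹) ^ K with hx
  have hLK : (1 : ℝ) ≤ (F.L : ℝ) ^ K := one_le_pow₀ hL1.le
  have hLK0 : (0 : ℝ) < (F.L : ℝ) ^ K := pow_pos hL0 K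
  have hinvK : ((F.L : ℝ)⁻¹) ^ K = ((F.L : ℝ) ^ K)⁻¹ := by rw [inv_pow]
  have hx0 : 0 < x := by rw [hx, hinvK]; positivity
  have hx1 : x ≤ 1 := by
    rw [hx, hinvK]
    calc γ * ((F.L : ℝ) ^ K)⁻¹ ≤ 1 * 1 := by
          gcongr; exact inv_le_one_of_one_le₀ hLK
      _ = 1 := one_mul 1
  have hxinv : x⁻¹ = γ⁻¹ * (F.L : ℝ) ^ K := by rw [hx, hinvK, mul_inv, inv_inv]
  set g : ℝ := Real.sqrt x with hg
  have hg0 : 0 < g := Real.sqrt_pos.mpr hx0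
  have hlogg : Real.log g⁻¹ = (K * ℓ - Real.log γ) / 2 := by
    rw [Real.log_inv, hg, Real.log_sqrt hx0.le, hx, Real.log_mul hγ.ne' (pow_ne_zero _ (inv_ne_zero hL0.ne')),
      Real.log_pow, Real.log_inv]
    ring
  set u : ℝ := 1 + Real.log g⁻¹ with hu
  have hu1 : 1 ≤ u := by
    rw [hu, hlogg]
    have : 0 ≤ (K : ℝ) * ℓ := by positivity
    linarith
  have huK : (K : ℝ) * ℓ / 2 ≤ u := by
    rw [hu, hlogg]; linarith
  -- `p(g_K) ≥ ½ b₀ K log L ≥ 0`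
  have hpF : B10.pFun b₀ p₀ g = b₀ * u ^ p₀ := rfl
  have hup : u ≤ u ^ p₀ := Real.self_le_rpow_of_one_le hu1 hp₀
  have hpF_ge : b₀ * ((K : ℝ) * ℓ / 2) ≤ B10.pFun b₀ p₀ g := by
    rw [hpF]
    calc b₀ * ((K : ℝ) * ℓ / 2) ≤ b₀ * u := by gcongr
      _ ≤ b₀ * u ^ p₀ := by gcongr
  have hpF0 : 0 ≤ B10.pFun b₀ p₀ g := le_trans (by positivity) hpF_ge
  -- the Gaussian factor
  have hexp : Real.exp (-(B10.pFun b₀ p₀ g ^ 2 / 4)) ≤ Real.exp (-(a * (K : ℝ) ^ 2)) := by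
    refine Real.exp_le_exp.mpr ?_
    have hsq : (b₀ * ((K : ℝ) * ℓ / 2)) ^ 2 ≤ B10.pFun b₀ p₀ g ^ 2 :=
      pow_le_pow_left₀ (by positivity) hpF_ge 2
    have : a * (K : ℝ) ^ 2 = (b₀ * ((K : ℝ) * ℓ / 2)) ^ 2 / 4 := by rw [ha]; ring
    rw [this]
    linarith
  -- the inverse coupling `β_K = x⁻¹ ≥ 1` and the polynomial factor
  have hβ : (F.scheme ℰp γ).β K = x⁻¹ := by rw [scheme_β_eq]
  have hβ1 : 1 ≤ x⁻¹ := one_le_inv_iff₀.mpr ⟨hx0, hx1⟩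
  have hβ1' : 1 ≤ (F.scheme ℰp γ).β K := by rw [hβ]; exact hβ1
  have hsqrt : Real.sqrt ((F.scheme ℰp γ).β K) ^ 9 ≤ γ⁻¹ ^ 5 * ((F.L : ℝ) ^ K) ^ 5 := by
    rw [hβ]
    calc Real.sqrt x⁻¹ ^ 9 ≤ (x⁻¹) ^ 5 := sqrt_pow_nine_le hβ1
      _ = γ⁻¹ ^ 5 * ((F.L : ℝ) ^ K) ^ 5 := by rw [hxinv]; ring
  -- the number of plaquettes
  have hM : ((F.P K).sitesPerDir 0 : ℝ) ^ 3 = 8 * (F.L : ℝ) ^ (3 * F.m) * ((F.L : ℝ) ^ K) ^ 3 := by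
    rw [sitesPerDir_zero]; push_cast; ring
  -- `L^{8K} e^{−aK²} ≤ e^{b²/4a} 2^{−K}`
  have hLpow : ((F.L : ℝ) ^ K) ^ 8 = Real.exp (8 * ((K : ℝ) * ℓ)) := by
    rw [← pow_mul, hℓ, show 8 * ((K : ℝ) * Real.log F.L) = ((K * 8 : ℕ) : ℝ) * Real.log F.L by push_cast; ring,
      Real.exp_nat_mul, Real.exp_log hL0]
  have hhalf : ((1 : ℝ) / 2) ^ K = Real.exp (-((K : ℝ) * Real.log 2)) := by
    rw [Real.exp_neg, Real.exp_nat_mul, Real.exp_log two_pos, one_div, inv_pow]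
  have hgauss : ((F.L : ℝ) ^ K) ^ 8 * Real.exp (-(a * (K : ℝ) ^ 2)) ≤
      Real.exp (b ^ 2 / (4 * a)) * ((1 : ℝ) / 2) ^ K := by
    rw [hLpow, hhalf, ← Real.exp_add, ← Real.exp_add]
    refine Real.exp_le_exp.mpr ?_
    have hq := quadratic_le ha0 b (K : ℝ)
    rw [hb] at hq ⊢
    nlinarith
  -- assemble
  refine (hbound F γ hγ b₀ p₀ K hβ1' hpF0).trans ?_
  have hC3 : 0 < (C ^ 3)⁻¹ := by positivity
  have step1 : (Fintype.card (Plaq (F.P K) 0) : ℝ) *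
      (2 * Real.exp 24 * (C ^ 3)⁻¹ * Real.sqrt ((F.scheme ℰp γ).β K) ^ 9 * Real.exp (-(B10.pFun b₀ p₀ g ^ 2 / 4))) ≤
      (9 * (8 * (F.L : ℝ) ^ (3 * F.m) * ((F.L : ℝ) ^ K) ^ 3)) *
        (2 * Real.exp 24 * (C ^ 3)⁻¹ * (γ⁻¹ ^ 5 * ((F.L : ℝ) ^ K) ^ 5) * Real.exp (-(a * (K : ℝ) ^ 2))) := by
    rw [← hM]
    gcongr
    exact card_plaq_le F K
  refine step1.trans ?_
  have step2 : (9 * (8 * (F.L : ℝ) ^ (3 * F.m) * ((F.L : ℝ) ^ K) ^ 3)) *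
      (2 * Real.exp 24 * (C ^ 3)⁻¹ * (γ⁻¹ ^ 5 * ((F.L : ℝ) ^ K) ^ 5) * Real.exp (-(a * (K : ℝ) ^ 2))) =
      (144 * Real.exp 24 * (C ^ 3)⁻¹ * (F.L : ℝ) ^ (3 * F.m) * γ⁻¹ ^ 5) *
        (((F.L : ℝ) ^ K) ^ 8 * Real.exp (-(a * (K : ℝ) ^ 2))) := by
    ring
  rw [step2]
  calc (144 * Real.exp 24 * (C ^ 3)⁻¹ * (F.L : ℝ) ^ (3 * F.m) * γ⁻¹ ^ 5) *
        (((F.L : ℝ) ^ K) ^ 8 * Real.exp (-(a * (K : ℝ) ^ 2)))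
      ≤ (144 * Real.exp 24 * (C ^ 3)⁻¹ * (F.L : ℝ) ^ (3 * F.m) * γ⁻¹ ^ 5) *
          (Real.exp (b ^ 2 / (4 * a)) * ((1 : ℝ) / 2) ^ K) := by
        gcongr
    _ = A * ((1 : ℝ) / 2) ^ K := by rw [hA]; ring

/-- **K2 IS REDUCED TO THE AVERAGED HEIGHTS** (`0 < γ ≤ 1`, `0 < b₀`, `1 ≤ p₀`):
`HeightTailAt F γ b₀ p₀ ↔ AveragedTailAt F γ b₀ p₀` — the bare term costs nothing. [cite: Balaban1985UV3, (71) p.273] -/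
theorem heightTailAt_iff_averagedTailAt (F : T3Family) {γ b₀ p₀ : ℝ} (hγ : 0 < γ) (hγ1 : γ ≤ 1) (hb₀ : 0 < b₀)
    (hp₀ : 1 ≤ p₀) : HeightTailAt F γ b₀ p₀ ↔ AveragedTailAt F γ b₀ p₀ := by
  rw [heightTailAt_iff_bare_and_averaged]
  exact ⟨fun h => h.2, fun h => ⟨bareTailAt F hγ hγ1 hb₀ hp₀, h⟩⟩

/-- **The route's K2 from the averaged heights alone**: under the route prefix (`∀ L, ∃ b₀ p₀ γ₁, …`) a profile for the
block-AVERAGED heights `j ≥ 1` with `0 < γ₁ ≤ 1`, `0 < b₀`, `1 ≤ p₀` gives `HeightTailAt`, hence (tree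
`historyTailAt_of_heightTailAt`) `HistoryTailAt F γ b₀ p₀ m` for every `m ≥ 1`. [cite: Balaban1985UV3, (71) p.273] -/
theorem historyTailAt_of_averagedTailAt (F : T3Family) {γ b₀ p₀ : ℝ} (hγ : 0 < γ) (hγ1 : γ ≤ 1) (hb₀ : 0 < b₀)
    (hp₀ : 1 ≤ p₀) {m : ℕ} (hm : 0 < m) (h : AveragedTailAt F γ b₀ p₀) : HistoryTailAt F γ b₀ p₀ m :=
  historyTailAt_of_heightTailAt F hγ.le hm ((heightTailAt_iff_averagedTailAt F hγ hγ1 hb₀ hp₀).mpr h)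

end Profile

end Literature.MathematicalPhysics.QuantumFieldTheory.Balaban1983to89.T3BareTailProfile

end
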